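import Mathlib.Combinatorics.SimpleGraph.Connectivity.Connected
import Literature.Probability.Percolation.GladkovThreeClusterDichotomyProofs
import Summits.CriticalPhenomena.PercolationContinuityZ3.Theorems.PercNearOneGluingNoHeavyLowerTailThreePointLBSwitchingClusters
import HarnessLib

/-!
# `NoHeavyLowerTail` (stmt-CriticalPhenomena-4575) — the graph ↔ cells dictionary, I: clusters of two configurations glued at three terminals

Support file (prover prim-ineq-gen-8 gen 36; `--supports stmt-CriticalPhenomena-4575`; memo
run/shared/lean/prim/prim-ineq-gen-8/FINDING-gen36-LEMMA-U.md §4, step (D1)(ii)).  Pure combinatorics: no definitions, no named facts, no sorries.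

SETTING.  Finite configurations (open edge sets) `S₁ S₂ : Finset (Sym2 V)` on a finite vertex type, terminals `a b c : V`, and the GLUING
HYPOTHESIS: every vertex meeting an edge of `S₁` and an edge of `S₂` is a terminal (the two pieces of the apex piece-union of memo gen 34 §2 meet
only in `{a, b, c}`).  Clusters are `Literature.Probability.Percolation.Gladkov.cl` (`v ∈ cl K x` iff `x ↔ v` through the open edges `K`); monotonicity and
transitivity of `cl` are `ThreePointLB.cl_mono` / `ThreePointLB.mem_cl_trans` of `…ThreePointLBSwitchingClusters.lean`.

* `glued_cl_core` — every vertex of the cluster of `a` in `S₁ ∪ S₂` lies in the `S₁`- or `S₂`-cluster of a terminal `t` that is JOINED to `a`, where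
  "joined" is the explicit two-step closure among three points (`t = a`, or `t = b` with
  `Φ_ab := AB₁ ∨ AB₂ ∨ ((AC₁ ∨ AC₂) ∧ (CB₁ ∨ CB₂))`, or `t = c` with `Φ_ac`; `AB_i := b ∈ cl S_i a`, …).  Proof: the set of such vertices
  contains `a` and is closed under `S₁ ∪ S₂`-adjacency (a vertex of `cl S_i t` other than `t` meets an `S_i`-edge, so if it also meets an
  `S_j`-edge it is a terminal, and the closure formula absorbs one more step), hence contains the cluster (`Gladkov.mem_of_walk`).
* `glued_ab_iff`, `glued_ac_iff`, `glued_bc_iff` — THE JOIN FORMULAS: `b ∈ cl (S₁ ∪ S₂) a ↔ Φ_ab`, `c ∈ cl (S₁ ∪ S₂) a ↔ Φ_ac`,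
  `c ∈ cl (S₁ ∪ S₂) b ↔ BC₁ ∨ BC₂ ∨ ((AB₁ ∨ AB₂) ∧ (AC₁ ∨ AC₂))` — i.e. the partition of `{a,b,c}` induced by `S₁ ∪ S₂` is the join of the
  partitions induced by `S₁` and `S₂`.  This is the combinatorial heart of the union lemma "cells of a glued graph = apex piece-union of the
  cells of the pieces" (memo §4 (D1)); the weight bookkeeping (D1)(i),(iii) is not in this file.
[folklore]
-/

namespace Summit.CriticalPhenomena.PercolationContinuityZ3.Theorems

namespace APL

open Literature.Probability.Percolation Literature.Probability.Percolation.Gladkov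
open scoped Classical

variable {V : Type*} [Fintype V] [DecidableEq V]

omit [DecidableEq V] in
/-- A vertex of a cluster other than its root meets an edge of the configuration. [folklore] -/
theorem exists_mem_edge_of_mem_cl {S : Finset (Sym2 V)} {t u : V} (hu : u ∈ cl S t) (hne : u ≠ t) :
    ∃ e ∈ S, u ∈ e := by
  rw [mem_cl] at hu
  obtain ⟨w⟩ := hu.symm
  cases w with
  | nil => exact absurd rfl hne
  | cons hadj _ =>
    rw [adj_iff] at hadj
    exact ⟨_, hadj.1, Sym2.mem_mk_left _ _⟩

omit [DecidableEq V] in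
/-- One absorption step of the two-step closure among three terminals (the invariant of `glued_cl_core`): if `t` is joined to `a`
and the terminal `u` lies in the `S₁`- or `S₂`-cluster of `t`, then `u` is joined to `a`. [folklore] -/
theorem glued_join_step (S₁ S₂ : Finset (Sym2 V)) (a b c t u : V)
    (hΨ : t = a ∨
      (t = b ∧ ((b ∈ cl S₁ a ∨ b ∈ cl S₂ a) ∨ ((c ∈ cl S₁ a ∨ c ∈ cl S₂ a) ∧ (b ∈ cl S₁ c ∨ b ∈ cl S₂ c)))) ∨
      (t = c ∧ ((c ∈ cl S₁ a ∨ c ∈ cl S₂ a) ∨ ((b ∈ cl S₁ a ∨ b ∈ cl S₂ a) ∧ (c ∈ cl S₁ b ∨ c ∈ cl S₂ b)))))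
    (huT : u = a ∨ u = b ∨ u = c) (hut : u ∈ cl S₁ t ∨ u ∈ cl S₂ t) :
    u = a ∨
      (u = b ∧ ((b ∈ cl S₁ a ∨ b ∈ cl S₂ a) ∨ ((c ∈ cl S₁ a ∨ c ∈ cl S₂ a) ∧ (b ∈ cl S₁ c ∨ b ∈ cl S₂ c)))) ∨
      (u = c ∧ ((c ∈ cl S₁ a ∨ c ∈ cl S₂ a) ∨ ((b ∈ cl S₁ a ∨ b ∈ cl S₂ a) ∧ (c ∈ cl S₁ b ∨ c ∈ cl S₂ b)))) := by
  rcases huT with hu | hu | hu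
  · exact Or.inl hu
  · subst hu
    refine Or.inr (Or.inl ⟨rfl, ?_⟩)
    rcases hΨ with ht | ⟨ht, hΦ⟩ | ⟨ht, hΦ⟩
    · subst ht; exact Or.inl hut
    · subst ht; exact hΦ
    · subst ht
      -- t = c: u (= b) ∈ cl S_i c, and c is joined to a
      rcases hΦ with hAC | ⟨hAB, _⟩
      · exact Or.inr ⟨hAC, hut⟩
      · exact Or.inl hAB
  · subst hu
    refine Or.inr (Or.inr ⟨rfl, ?_⟩)
    rcases hΨ with ht | ⟨ht, hΦ⟩ | ⟨ht, hΦ⟩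
    · subst ht; exact Or.inl hut
    · subst ht
      rcases hΦ with hAB | ⟨hAC, _⟩
      · exact Or.inr ⟨hAB, hut⟩
      · exact Or.inl hAC
    · subst ht; exact hΦ

/-- **Core of the gluing lemma.**  Under the gluing hypothesis, every vertex of `cl (S₁ ∪ S₂) a` lies in `cl S₁ t ∪ cl S₂ t` for a terminal
`t` joined to `a` (two-step closure, see `glued_join_step`). [folklore] -/
theorem glued_cl_core (S₁ S₂ : Finset (Sym2 V)) (a b c : V)
    (hsep : ∀ v : V, (∃ e ∈ S₁, v ∈ e) → (∃ e ∈ S₂, v ∈ e) → (v = a ∨ v = b ∨ v = c))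
    {v : V} (hv : v ∈ cl (S₁ ∪ S₂) a) :
    ∃ t : V, (t = a ∨
      (t = b ∧ ((b ∈ cl S₁ a ∨ b ∈ cl S₂ a) ∨ ((c ∈ cl S₁ a ∨ c ∈ cl S₂ a) ∧ (b ∈ cl S₁ c ∨ b ∈ cl S₂ c)))) ∨
      (t = c ∧ ((c ∈ cl S₁ a ∨ c ∈ cl S₂ a) ∨ ((b ∈ cl S₁ a ∨ b ∈ cl S₂ a) ∧ (c ∈ cl S₁ b ∨ c ∈ cl S₂ b))))) ∧
      (v ∈ cl S₁ t ∨ v ∈ cl S₂ t) := by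
  -- the candidate set
  set C : Finset V := Finset.univ.filter fun v => ∃ t : V, (t = a ∨
      (t = b ∧ ((b ∈ cl S₁ a ∨ b ∈ cl S₂ a) ∨ ((c ∈ cl S₁ a ∨ c ∈ cl S₂ a) ∧ (b ∈ cl S₁ c ∨ b ∈ cl S₂ c)))) ∨
      (t = c ∧ ((c ∈ cl S₁ a ∨ c ∈ cl S₂ a) ∨ ((b ∈ cl S₁ a ∨ b ∈ cl S₂ a) ∧ (c ∈ cl S₁ b ∨ c ∈ cl S₂ b))))) ∧
      (v ∈ cl S₁ t ∨ v ∈ cl S₂ t) with hC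
  have hmemC : ∀ v, v ∈ C ↔ ∃ t : V, (t = a ∨
      (t = b ∧ ((b ∈ cl S₁ a ∨ b ∈ cl S₂ a) ∨ ((c ∈ cl S₁ a ∨ c ∈ cl S₂ a) ∧ (b ∈ cl S₁ c ∨ b ∈ cl S₂ c)))) ∨
      (t = c ∧ ((c ∈ cl S₁ a ∨ c ∈ cl S₂ a) ∨ ((b ∈ cl S₁ a ∨ b ∈ cl S₂ a) ∧ (c ∈ cl S₁ b ∨ c ∈ cl S₂ b))))) ∧
      (v ∈ cl S₁ t ∨ v ∈ cl S₂ t) := fun v => by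
    rw [hC, Finset.mem_filter]
    exact ⟨fun h => h.2, fun h => ⟨Finset.mem_univ _, h⟩⟩
  have haC : a ∈ C := (hmemC a).2 ⟨a, Or.inl rfl, Or.inl (mem_cl_self _ _)⟩
  -- closedness under adjacency in the glued configuration
  have hclosed : ∀ u v, u ∈ C → (openGraph (↑(S₁ ∪ S₂) : Set (Sym2 V))).Adj u v → v ∈ C := by
    intro u v hu huv
    obtain ⟨t, hΨ, hut⟩ := (hmemC u).1 hu
    rw [adj_iff, Finset.mem_union] at huv
    obtain ⟨he | he, hne⟩ := huv
    · -- the edge `s(u,v)` is in `S₁`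
      have hadj1 : (openGraph (↑S₁ : Set (Sym2 V))).Adj u v := adj_iff.2 ⟨he, hne⟩
      rcases hut with hu1 | hu2
      · exact (hmemC v).2 ⟨t, hΨ, Or.inl (mem_cl_of_adj hu1 hadj1)⟩
      · -- `u ∈ cl S₂ t` and `u` meets an `S₁`-edge: `u = t` or `u` is a terminal
        by_cases hut' : u = t
        · subst hut'
          exact (hmemC v).2 ⟨u, hΨ, Or.inl (mem_cl_of_adj (mem_cl_self _ _) hadj1)⟩
        · obtain ⟨e, he2, hue⟩ := exists_mem_edge_of_mem_cl hu2 hut'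
          have huT : u = a ∨ u = b ∨ u = c := hsep u ⟨_, he, Sym2.mem_mk_left _ _⟩ ⟨e, he2, hue⟩
          have hΨ' := glued_join_step S₁ S₂ a b c t u hΨ huT (Or.inr hu2)
          exact (hmemC v).2 ⟨u, hΨ', Or.inl (mem_cl_of_adj (mem_cl_self _ _) hadj1)⟩
    · -- the edge `s(u,v)` is in `S₂`
      have hadj2 : (openGraph (↑S₂ : Set (Sym2 V))).Adj u v := adj_iff.2 ⟨he, hne⟩
      rcases hut with hu1 | hu2
      · by_cases hut' : u = t
        · subst hut'
          exact (hmemC v).2 ⟨u, hΨ, Or.inr (mem_cl_of_adj (mem_cl_self _ _) hadj2)⟩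
        · obtain ⟨e, he1, hue⟩ := exists_mem_edge_of_mem_cl hu1 hut'
          have huT : u = a ∨ u = b ∨ u = c := hsep u ⟨e, he1, hue⟩ ⟨_, he, Sym2.mem_mk_left _ _⟩
          have hΨ' := glued_join_step S₁ S₂ a b c t u hΨ huT (Or.inl hu1)
          exact (hmemC v).2 ⟨u, hΨ', Or.inr (mem_cl_of_adj (mem_cl_self _ _) hadj2)⟩
      · exact (hmemC v).2 ⟨t, hΨ, Or.inr (mem_cl_of_adj hu2 hadj2)⟩
  -- walk from `a` to `v`
  rw [mem_cl] at hv
  obtain ⟨w⟩ := hv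
  exact (hmemC v).1 (mem_of_walk hclosed w haC)

/-- **Join formula, `a ~ b`.**  Under the gluing hypothesis:
`b ∈ cl (S₁ ∪ S₂) a ↔ AB₁ ∨ AB₂ ∨ ((AC₁ ∨ AC₂) ∧ (CB₁ ∨ CB₂))`. [folklore] -/
theorem glued_ab_iff (S₁ S₂ : Finset (Sym2 V)) (a b c : V)
    (hsep : ∀ v : V, (∃ e ∈ S₁, v ∈ e) → (∃ e ∈ S₂, v ∈ e) → (v = a ∨ v = b ∨ v = c)) :
    b ∈ cl (S₁ ∪ S₂) a ↔
      ((b ∈ cl S₁ a ∨ b ∈ cl S₂ a) ∨ ((c ∈ cl S₁ a ∨ c ∈ cl S₂ a) ∧ (b ∈ cl S₁ c ∨ b ∈ cl S₂ c))) := by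
  constructor
  · intro hb
    obtain ⟨t, hΨ, hbt⟩ := glued_cl_core S₁ S₂ a b c hsep hb
    have h := glued_join_step S₁ S₂ a b c t b hΨ (Or.inr (Or.inl rfl)) hbt
    rcases h with hba | ⟨_, hΦ⟩ | ⟨hbc, hΦ⟩
    · subst hba; exact Or.inl (Or.inl (mem_cl_self _ _))
    · exact hΦ
    · -- b = c
      subst hbc
      rcases hΦ with h1 | ⟨h2, _⟩
      · exact Or.inl h1
      · exact Or.inl h2
  · rintro (hab | ⟨hac, hcb⟩)
    · rcases hab with h | h
      · exact ThreePointLB.cl_mono Finset.subset_union_left _ h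
      · exact ThreePointLB.cl_mono Finset.subset_union_right _ h
    · have hac' : c ∈ cl (S₁ ∪ S₂) a := by
        rcases hac with h | h
        · exact ThreePointLB.cl_mono Finset.subset_union_left _ h
        · exact ThreePointLB.cl_mono Finset.subset_union_right _ h
      have hcb' : b ∈ cl (S₁ ∪ S₂) c := by
        rcases hcb with h | h
        · exact ThreePointLB.cl_mono Finset.subset_union_left _ h
        · exact ThreePointLB.cl_mono Finset.subset_union_right _ h
      exact ThreePointLB.mem_cl_trans hac' hcb'

/-- **Join formula, `a ~ c`** (the `b ↔ c` mirror of `glued_ab_iff`). [folklore] -/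
theorem glued_ac_iff (S₁ S₂ : Finset (Sym2 V)) (a b c : V)
    (hsep : ∀ v : V, (∃ e ∈ S₁, v ∈ e) → (∃ e ∈ S₂, v ∈ e) → (v = a ∨ v = b ∨ v = c)) :
    c ∈ cl (S₁ ∪ S₂) a ↔
      ((c ∈ cl S₁ a ∨ c ∈ cl S₂ a) ∨ ((b ∈ cl S₁ a ∨ b ∈ cl S₂ a) ∧ (c ∈ cl S₁ b ∨ c ∈ cl S₂ b))) :=
  glued_ab_iff S₁ S₂ a c b fun v h1 h2 => by
    rcases hsep v h1 h2 with h | h | h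
    · exact Or.inl h
    · exact Or.inr (Or.inr h)
    · exact Or.inr (Or.inl h)

/-- **Join formula, `b ~ c`** (apex `b`): `c ∈ cl (S₁ ∪ S₂) b ↔ BC₁ ∨ BC₂ ∨ ((BA₁ ∨ BA₂) ∧ (AC₁ ∨ AC₂))`, stated with the
`a`-rooted atoms via the symmetry of `cl`. [folklore] -/
theorem glued_bc_iff (S₁ S₂ : Finset (Sym2 V)) (a b c : V)
    (hsep : ∀ v : V, (∃ e ∈ S₁, v ∈ e) → (∃ e ∈ S₂, v ∈ e) → (v = a ∨ v = b ∨ v = c)) :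
    c ∈ cl (S₁ ∪ S₂) b ↔
      ((c ∈ cl S₁ b ∨ c ∈ cl S₂ b) ∨ ((b ∈ cl S₁ a ∨ b ∈ cl S₂ a) ∧ (c ∈ cl S₁ a ∨ c ∈ cl S₂ a))) := by
  have h := glued_ab_iff S₁ S₂ b c a fun v h1 h2 => by
    rcases hsep v h1 h2 with h | h | h
    · exact Or.inr (Or.inr h)
    · exact Or.inl h
    · exact Or.inr (Or.inl h)
  -- h : c ∈ cl (S₁ ∪ S₂) b ↔ (c ∈ cl S₁ b ∨ c ∈ cl S₂ b) ∨ ((a ∈ cl S₁ b ∨ a ∈ cl S₂ b) ∧ (c ∈ cl S₁ a ∨ c ∈ cl S₂ a))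
  rw [h]
  constructor
  · rintro (h1 | ⟨h2, h3⟩)
    · exact Or.inl h1
    · refine Or.inr ⟨?_, h3⟩
      rcases h2 with h | h
      · exact Or.inl (mem_cl_comm.1 h)
      · exact Or.inr (mem_cl_comm.1 h)
  · rintro (h1 | ⟨h2, h3⟩)
    · exact Or.inl h1
    · refine Or.inr ⟨?_, h3⟩
      rcases h2 with h | h
      · exact Or.inl (mem_cl_comm.1 h)
      · exact Or.inr (mem_cl_comm.1 h)

end APL

end Summit.CriticalPhenomena.PercolationContinuityZ3.Theorems
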